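import Summits.NavierStokesRegularity.NavierStokesRegularity.Theses.CoriolisHead
import Summits.NavierStokesRegularity.NavierStokesRegularity.Theorems.CoriolisHeadNoCoRotatingCoreSmallAmplitude
import Literature.Analysis.FluidPDE.FlatSwirlGaugeRelabel
import Literature.Analysis.FluidPDE.KNSSAxisymmetricNoSwirl
import Summits.NavierStokesRegularity.NavierStokesRegularity.Theorems.TypeICertificateLadderTargetSolitonLawsProfile
import HarnessLib

/-!
# Route CoriolisHead · crux `NoCoRotatingCore` (stmt-NavierStokesRegularity-22676) —
# translation symmetry of the rotated profile system; the constant family is ISOLATED in `L^∞`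

Support file (`--supports stmt-NavierStokesRegularity-22676`; theorems only, no definitions, no named
facts).  The small-amplitude Liouville theorem (`exists_eps_rotatedProfile_const_of_small_amplitude`,
file `CoriolisHeadNoCoRotatingCoreSmallAmplitude`: `(sup |U|)² < ε · aν ⇒ U` constant, every skew
frame rate `B`) is centred at the trivial profile `U ≡ 0`.  The rotated Leray profile system

  `−νΔU + aU + a DU[y] + (BU − DU[By]) + DU[U] + ∇P = 0`, `div U = 0`,

has an exact TRANSLATION SYMMETRY with a drift correction (the similarity-variables shadow of the
translation of the blow-up point):

* `rotatedProfileSystem_translate` — for every `c ∈ ℝ³`, `V(y) = U(y − c) + (Bc − ac)`,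
  `Q(y) = P(y − c) − ⟪a(Bc − ac) + B(Bc − ac), y⟫` solve the same system (the extra terms are
  `DU[ac − Bc + d]` with `d = Bc − ac`, and the constant force `ad + Bd`, a gradient).  The orbit of
  `U ≡ 0` is the whole constant family `U ≡ b` (`b = (B − a)c`; `B − a` is invertible since
  `⟪(a − B)x, x⟫ = a|x|²`: `exists_sub_clm_apply_eq`).

Consequences (all at EVERY rotation rate, any `ν, a > 0`):

* `exists_eps_rotatedProfile_const_of_small_oscillation` — **ISOLATION OF THE CONSTANT FAMILY**: with
  the same absolute `ε`, a smooth bounded rotated profile which is uniformly close to SOME constant,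
  `sup_y |U(y) − b|² < ε · aν`, is constant.
* `noCoRotatingCore_of_small_oscillation` — the corresponding RUNG of `NoCoRotatingCore` (crux binders
  verbatim + the oscillation bound ⇒ `0 ≤ Σₗ (B ∂ₗU)ₗ`).
* `rss_profile_eq_zero_of_small_typeI` — the small-data theorem in the EXACT BINDERS of Pineau–Vicol's
  Theorem 1.4 / Conjecture 1.1 (tree: `pineauVicol2026_rss_liouville`): a classical Navier–Stokes
  solution on `ℝ³ × [−1, 0)` with the Type I bound (1.10) `|u(t,x)| ≤ C₀/(|x| + √(−t))` which is the RSS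
  ansatz (1.7) of a profile `U` with ANY angular speed `α` has `U ≡ 0` as soon as `C₀ < ε₁` (absolute);
  print has this for every `C₀` but only for `|α| ≪ 1` or `|α| ≫ 1`.
* `oscillation_lower_bound_of_nonconstant` — NECESSARY CONDITION FOR A COUNTEREXAMPLE to `X`: a
  nonconstant smooth bounded rotated profile stays at uniform distance `≥ √(ε aν)` from every
  constant: `sup_y |U(y) − b|² ≥ ε · aν` for all `b` (complementing the census of
  `CoriolisHeadNoCoRotatingCoreReduction` / `…StrainThreshold`: super-threshold stretching somewhere,
  vorticity entering the open co-rotation ball).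

HONEST FRAMING.  Decided regime / necessary conditions only; `NoCoRotatingCore` (⟺ `X`, Pineau–Vicol
Conj. 1.1 in bounded all-α form) stays OPEN for profiles far from the constants, and Navier–Stokes
regularity is NOT proved here.

References: B. Pineau, V. Vicol, arXiv:2607.09619 (2026), (1.8), Conj. 1.1 [PineauVicol2026];
G. Koch, N. Nadirashvili, G. Seregin, V. Šverák, Acta Math. 203 (2009) = arXiv:0709.3599, §1
(symmetries; parasitic solutions) [KochNadirashviliSereginSverak2009].
-/

noncomputable section

-- the summit and its single sub-problem share the name (CONVENTIONS §1), as in every Theorems file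
set_option linter.dupNamespace false

open Set Function
open scoped ContDiff Laplacian RealInnerProductSpace BigOperators
open Literature.Analysis.FluidPDE
open Summit.NavierStokesRegularity.NavierStokesRegularity.Theses

namespace Summit.NavierStokesRegularity.NavierStokesRegularity.Theorems.CoriolisHead

/-! ### Translation symmetry -/

/-- **Translation symmetry of the rotated Leray profile system.** If `(U, P)` (`P` differentiable)
solves `−νΔU + aU + a DU[y] + (BU − DU[By]) + DU[U] + ∇P = 0`, then for every `c` so does the pair
`V(y) = U(y − c) + d`, `Q(y) = P(y − c) − ⟪ad + Bd, y⟫` with `d = Bc − ac`: at `y = x + c` the new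
system is the old one at `x` plus `DU(x)[ac − Bc + d] = 0` plus the constant `ad + Bd − (ad + Bd) = 0`.
(For `B = 0` this is the classical translation/boost symmetry of Leray's equation.)
[cite: KochNadirashviliSereginSverak2009, §1 (arXiv:0709.3599 p. 3), symmetries of Navier–Stokes] -/
theorem rotatedProfileSystem_translate {ν a : ℝ}
    {B : EuclideanSpace ℝ (Fin 3) →L[ℝ] EuclideanSpace ℝ (Fin 3)}
    {U : EuclideanSpace ℝ (Fin 3) → EuclideanSpace ℝ (Fin 3)} {P : EuclideanSpace ℝ (Fin 3) → ℝ}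
    (hP : Differentiable ℝ P)
    (heq : ∀ y, -(ν • (Δ U) y) + a • U y + a • fderiv ℝ U y y + (B (U y) - fderiv ℝ U y (B y))
      + convect U U y + gradient P y = 0) (c y : EuclideanSpace ℝ (Fin 3)) :
    -(ν • (Δ (fun w => U (w + -c) + (B c - a • c))) y)
      + a • (U (y + -c) + (B c - a • c))
      + a • fderiv ℝ (fun w => U (w + -c) + (B c - a • c)) y y
      + (B (U (y + -c) + (B c - a • c)) - fderiv ℝ (fun w => U (w + -c) + (B c - a • c)) y (B y))
      + convect (fun w => U (w + -c) + (B c - a • c)) (fun w => U (w + -c) + (B c - a • c)) y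
      + gradient (fun w => P (w + -c)
          - ⟪a • (B c - a • c) + B (B c - a • c), w⟫) y = 0 := by
  set x : EuclideanSpace ℝ (Fin 3) := y + -c with hx
  set d : EuclideanSpace ℝ (Fin 3) := B c - a • c with hd
  have hyx : y = x + c := by rw [hx]; abel
  -- the differential operators do not see the translation and the added constant
  have hΔ : (Δ (fun w => U (w + -c) + d)) y = (Δ U) x := by
    rw [laplacian_fun_add_const, laplacian_comp_add_const]
  have hD : fderiv ℝ (fun w => U (w + -c) + d) y = fderiv ℝ U x := by
    rw [fderiv_add_const, fderiv_comp_add_right]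
  have hG : gradient (fun w => P (w + -c) - ⟪a • d + B d, w⟫) y = gradient P x - (a • d + B d) := by
    have h1 : DifferentiableAt ℝ (fun w => P (w + -c)) y :=
      (hP.comp (differentiable_id.add (differentiable_const _))).differentiableAt
    have h2 : DifferentiableAt ℝ (fun w : EuclideanSpace ℝ (Fin 3) => ⟪a • d + B d, w⟫) y :=
      (innerSL ℝ (a • d + B d)).differentiableAt
    rw [gradient, fderiv_fun_sub h1 h2, map_sub, ← gradient, ← gradient, gradient_comp_add_const,
      gradient_inner_const_left]
  have key := heq x
  simp only [convect_apply] at key ⊢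
  rw [hΔ, hD, hG, hyx, map_add B x c]
  simp only [hd, map_add, map_sub, map_smul, smul_add, smul_sub, add_neg_cancel_right]
  linear_combination (norm := module) key

/-- The drift map `c ↦ ac − Bc` is onto (it is injective, `⟪ac − Bc, c⟫ = a|c|²`, on a
finite-dimensional space): every constant `b` is `ac − Bc` for some `c` (`a ≠ 0`, `B` skew). [folklore] -/
theorem exists_sub_clm_apply_eq {a : ℝ} (ha : a ≠ 0)
    {B : EuclideanSpace ℝ (Fin 3) →L[ℝ] EuclideanSpace ℝ (Fin 3)} (hB : ∀ x, ⟪B x, x⟫ = 0)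
    (b : EuclideanSpace ℝ (Fin 3)) : ∃ c : EuclideanSpace ℝ (Fin 3), a • c - B c = b := by
  set T : EuclideanSpace ℝ (Fin 3) →ₗ[ℝ] EuclideanSpace ℝ (Fin 3) :=
    a • LinearMap.id - (B : EuclideanSpace ℝ (Fin 3) →ₗ[ℝ] EuclideanSpace ℝ (Fin 3)) with hT
  have hTapply : ∀ c, T c = a • c - B c := fun c => by simp [hT]
  have hinj : Function.Injective T := by
    refine (injective_iff_map_eq_zero T).2 fun c hc => ?_
    have h1 : ⟪T c, c⟫ = a * ‖c‖ ^ 2 := by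
      rw [hTapply, inner_sub_left, real_inner_smul_left, hB c, sub_zero, real_inner_self_eq_norm_sq]
    rw [hc, inner_zero_left] at h1
    have h2 : ‖c‖ ^ 2 = 0 := by
      rcases mul_eq_zero.1 h1.symm with h | h
      · exact absurd h ha
      · exact h
    exact norm_eq_zero.1 (pow_eq_zero_iff two_ne_zero |>.1 h2)
  obtain ⟨c, hc⟩ := (LinearMap.injective_iff_surjective.1 hinj) b
  exact ⟨c, by rw [← hTapply, hc]⟩

/-! ### Isolation of the constant family -/

/-- **Rotated profiles uniformly close to a constant are constant (every rotation rate).** There is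
an absolute `ε > 0` (that of `exists_eps_rotatedProfile_const_of_small_amplitude`) such that: for all
`ν, a > 0`, every skew `B`, every smooth divergence-free solution `(U, P)` of the rotated Leray profile
system, every constant `b` and every `M` with `sup_y |U(y) − b| ≤ M` and `M² < ε · aν`, the profile
`U` is constant.  Proof: pick `c` with `ac − Bc = b`; the translate `V(y) = U(y − c) − b` is again a
bounded rotated profile (`rotatedProfileSystem_translate`) with `sup |V| ≤ M`, hence constant.
[cite: PineauVicol2026, Conjecture 1.1 (arXiv:2607.09619 p. 3)] -/
theorem exists_eps_rotatedProfile_const_of_small_oscillation :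
    ∃ ε : ℝ, 0 < ε ∧ ∀ (ν a : ℝ), 0 < ν → 0 < a →
      ∀ (B : EuclideanSpace ℝ (Fin 3) →L[ℝ] EuclideanSpace ℝ (Fin 3))
        (U : EuclideanSpace ℝ (Fin 3) → EuclideanSpace ℝ (Fin 3)) (P : EuclideanSpace ℝ (Fin 3) → ℝ),
        ContDiff ℝ (⊤ : ℕ∞) U → ContDiff ℝ 2 P → (∀ x, inner ℝ (B x) x = 0) →
        Literature.Analysis.FluidPDE.VectorCalculus.IsDivFree U →
        (∀ y, -(ν • Laplacian.laplacian U y) + a • U y + a • fderiv ℝ U y y + (B (U y) - fderiv ℝ U y (B y))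
          + Literature.Analysis.FluidPDE.convect U U y + gradient P y = 0) →
        ∀ (b : EuclideanSpace ℝ (Fin 3)) (M : ℝ), (∀ y, ‖U y - b‖ ≤ M) → M ^ 2 < ε * (a * ν) →
        ∃ b' : EuclideanSpace ℝ (Fin 3), ∀ y, U y = b' := by
  obtain ⟨ε, hε, h⟩ := exists_eps_rotatedProfile_const_of_small_amplitude
  refine ⟨ε, hε, ?_⟩
  intro ν a hν ha B U P hU hP hB hdiv heq b M hM hsmall
  -- the translation that kills `b`
  obtain ⟨c, hc⟩ := exists_sub_clm_apply_eq ha.ne' hB b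
  have hd : B c - a • c = -b := by rw [← hc]; abel
  set V : EuclideanSpace ℝ (Fin 3) → EuclideanSpace ℝ (Fin 3) := fun w => U (w + -c) + (B c - a • c)
    with hV
  set Q : EuclideanSpace ℝ (Fin 3) → ℝ := fun w => P (w + -c)
    - ⟪a • (B c - a • c) + B (B c - a • c), w⟫ with hQ
  have hVU : ∀ w, V w = U (w + -c) - b := fun w => by
    simp only [hV, hd]; abel
  have hVs : ContDiff ℝ (⊤ : ℕ∞) V :=
    (hU.comp (contDiff_id.add contDiff_const)).add contDiff_const
  have hQs : ContDiff ℝ 2 Q :=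
    (hP.comp (contDiff_id.add contDiff_const)).sub (innerSL ℝ _).contDiff
  have hdivV : VectorCalculus.IsDivFree V := fun w => by
    simp only [hV, VectorCalculus.divergence, fderiv_add_const, fderiv_comp_add_right]
    exact hdiv _
  have heqV : ∀ y, -(ν • Laplacian.laplacian V y) + a • V y + a • fderiv ℝ V y y
      + (B (V y) - fderiv ℝ V y (B y)) + convect V V y + gradient Q y = 0 := fun y =>
    rotatedProfileSystem_translate (hP.differentiable (by norm_num)) heq c y
  have hVb : ∀ w, ‖V w‖ ≤ M := fun w => by rw [hVU]; exact hM _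
  obtain ⟨b', hb'⟩ := h ν a hν ha B V Q hVs hQs hB hdivV heqV M hVb hsmall
  refine ⟨b' + b, fun y => ?_⟩
  have h1 := hb' (y + c)
  rw [hVU, add_neg_cancel_right] at h1
  rw [← h1, sub_add_cancel]

/-- **RUNG of `NoCoRotatingCore`: no co-rotating core for profiles uniformly close to a constant,
every rotation rate.**  The binders of `CoriolisHead.NoCoRotatingCore` verbatim plus
`sup_y |U(y) − b| ≤ M`, `M² < ε · aν` (absolute `ε`) give the crux's conclusion `0 ≤ Σₗ (B ∂ₗU(y))ₗ`
(the profile is constant).  The crux far from the constants remains open.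
[cite: PineauVicol2026, Conjecture 1.1 (arXiv:2607.09619 p. 3)] -/
theorem noCoRotatingCore_of_small_oscillation :
    ∃ ε : ℝ, 0 < ε ∧ ∀ (ν a : ℝ), 0 < ν → 0 < a →
      ∀ (B : EuclideanSpace ℝ (Fin 3) →L[ℝ] EuclideanSpace ℝ (Fin 3))
        (U : EuclideanSpace ℝ (Fin 3) → EuclideanSpace ℝ (Fin 3)) (P : EuclideanSpace ℝ (Fin 3) → ℝ),
        ContDiff ℝ (⊤ : ℕ∞) U → ContDiff ℝ 2 P → (∀ x, inner ℝ (B x) x = 0) →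
        Literature.Analysis.FluidPDE.VectorCalculus.IsDivFree U →
        (∀ y, -(ν • Laplacian.laplacian U y) + a • U y + a • fderiv ℝ U y y + (B (U y) - fderiv ℝ U y (B y))
          + Literature.Analysis.FluidPDE.convect U U y + gradient P y = 0) →
        (∃ M : ℝ, ∀ y, ‖U y‖ ≤ M) →
        ∀ (b : EuclideanSpace ℝ (Fin 3)) (M : ℝ), (∀ y, ‖U y - b‖ ≤ M) → M ^ 2 < ε * (a * ν) →
        ∀ y, 0 ≤ ∑ l, (B (fderiv ℝ U y (EuclideanSpace.single l 1))) l := by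
  obtain ⟨ε, hε, h⟩ := exists_eps_rotatedProfile_const_of_small_oscillation
  refine ⟨ε, hε, ?_⟩
  intro ν a hν ha B U P hU hP hB hdiv heq _hbdd b M hM hsmall y
  obtain ⟨b', hb'⟩ := h ν a hν ha B U P hU hP hB hdiv heq b M hM hsmall
  have hUc : U = fun _ => b' := funext hb'
  have hD : fderiv ℝ U y = 0 := by
    rw [hUc]
    exact fderiv_const_apply b'
  simp [hD]

/-- **Necessary condition for a counterexample to `X`: uniform distance from the constants.** With
the absolute `ε` above: a NONCONSTANT smooth bounded rotated Leray profile (any `ν, a > 0`, any skew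
`B`) satisfies `sup_y |U(y) − b|² ≥ ε · aν` for every constant `b` — in the rendering without `sup`:
whenever `|U(y) − b| ≤ M` for all `y`, then `ε · aν ≤ M²`. [cite: PineauVicol2026, Conjecture 1.1 (arXiv:2607.09619 p. 3)] -/
theorem oscillation_lower_bound_of_nonconstant :
    ∃ ε : ℝ, 0 < ε ∧ ∀ (ν a : ℝ), 0 < ν → 0 < a →
      ∀ (B : EuclideanSpace ℝ (Fin 3) →L[ℝ] EuclideanSpace ℝ (Fin 3))
        (U : EuclideanSpace ℝ (Fin 3) → EuclideanSpace ℝ (Fin 3)) (P : EuclideanSpace ℝ (Fin 3) → ℝ),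
        ContDiff ℝ (⊤ : ℕ∞) U → ContDiff ℝ 2 P → (∀ x, inner ℝ (B x) x = 0) →
        Literature.Analysis.FluidPDE.VectorCalculus.IsDivFree U →
        (∀ y, -(ν • Laplacian.laplacian U y) + a • U y + a • fderiv ℝ U y y + (B (U y) - fderiv ℝ U y (B y))
          + Literature.Analysis.FluidPDE.convect U U y + gradient P y = 0) →
        (∃ y y', U y ≠ U y') →
        ∀ (b : EuclideanSpace ℝ (Fin 3)) (M : ℝ), (∀ y, ‖U y - b‖ ≤ M) → ε * (a * ν) ≤ M ^ 2 := by
  obtain ⟨ε, hε, h⟩ := exists_eps_rotatedProfile_const_of_small_oscillation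
  refine ⟨ε, hε, ?_⟩
  intro ν a hν ha B U P hU hP hB hdiv heq hnc b M hM
  by_contra hlt
  push Not at hlt
  obtain ⟨b', hb'⟩ := h ν a hν ha B U P hU hP hB hdiv heq b M hM hlt
  obtain ⟨y, y', hne⟩ := hnc
  exact hne (by rw [hb' y, hb' y'])

/-! ### Pineau–Vicol's binders: small Type-I constant, every angular speed -/

/-- **Conjecture 1.1 / Theorem 1.4 of Pineau–Vicol for SMALL Type-I constant at EVERY angular speed.**
There is an absolute `ε₁ > 0` such that: if `(u, p)` is a classical Navier–Stokes solution (`ν = 1`,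
no force) on `ℝ³ × [−1, 0)` with the Type I bound `‖u(t, x)‖ ≤ C₀/(‖x‖ + √(−t))` (1.10), and `u` is
backwards rotated self-similar with ANY angular speed `α ∈ ℝ` and profile `U` (ansatz (1.7),
`u = pvAnsatz α U`), then `C₀ < ε₁` forces `U ≡ 0`.  Proof: the profile is smooth, divergence free and
solves (1.8) with a smooth pressure (tree: `rss_profile_system`), obeys (1.9) `‖U(y)‖ ≤ C₀/(1 + ‖y‖)`
(tree: `norm_profile_le_of_typeI_slice` at `t = −1`), and `pvProfile_eq_zero_of_small_typeI` applies.
Compare `pineauVicol2026_rss_liouville` (every `C₀`, extreme `|α|` only).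
[cite: PineauVicol2026, Conjecture 1.1, Remark 1.2 and Theorem 1.4 (arXiv:2607.09619 pp. 3–4)] -/
theorem rss_profile_eq_zero_of_small_typeI :
    ∃ ε₁ : ℝ, 0 < ε₁ ∧ ∀ (C₀ α : ℝ)
      (u : ℝ → EuclideanSpace ℝ (Fin 3) → EuclideanSpace ℝ (Fin 3)) (p : ℝ → EuclideanSpace ℝ (Fin 3) → ℝ)
      (U : EuclideanSpace ℝ (Fin 3) → EuclideanSpace ℝ (Fin 3)),
      IsClassicalNSSolutionOn (Ico (-1) 0) 1 0 u p →
      (∀ t ∈ Ico (-1 : ℝ) 0, ∀ x, ‖u t x‖ ≤ C₀ / (‖x‖ + Real.sqrt (-t))) →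
      (∀ t ∈ Ico (-1 : ℝ) 0, ∀ x, u t x = pvAnsatz α (fun y _ => U y) t x) →
      C₀ < ε₁ → U = 0 := by
  obtain ⟨ε₁, hε₁, h⟩ := pvProfile_eq_zero_of_small_typeI
  refine ⟨ε₁, hε₁, ?_⟩
  intro C₀ α u p U hsol hI hans hC₀
  obtain ⟨P, hU, hP, hdiv, heq⟩ := rss_profile_system α u p U hsol hans
  have h1 : (-1 : ℝ) ∈ Ico (-1 : ℝ) 0 := ⟨le_rfl, by norm_num⟩
  have hK : ∀ y, ‖U y‖ ≤ C₀ / (‖y‖ + 1) := fun y => by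
    have h2 := PineauVicol2026.norm_profile_le_of_typeI_slice hI hans h1 y
    rwa [add_comm (1 : ℝ)] at h2
  exact h α U P hU (hP.of_le (by norm_cast)) hdiv heq C₀ hK hC₀

end Summit.NavierStokesRegularity.NavierStokesRegularity.Theorems.CoriolisHead

end
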